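import Mathlib.Analysis.InnerProductSpace.PiL2
import Mathlib.LinearAlgebra.Matrix.ToLinearEquiv
import Mathlib.LinearAlgebra.Dimension.Finite
import Summits.AtomisticToContinuum.Crystallization.Theses.TwoCentreKissingKernel
import HarnessLib

/-!
# `RobustTangencyBound` — the robust rhombus relation between the diagonals of a soft square (helper)

Route `TwoCentreKissingKernel`, item `stmt-AtomisticToContinuum-12082`, step (III) of its programme
(Lemma Q of the blueprint: Bezdek–Reid's Quadrilateral Lemma with slack).  For an EXACT unit rhombus
`v a w c` on the unit sphere (four contacts `⟪v,a⟫ = ⟪a,w⟫ = ⟪w,c⟫ = ⟪c,v⟫ = 1/2`) the diagonals satisfy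
`(1 + ⟪v, w⟫)(1 + ⟪a, c⟫) = 1` (the tree's `rhombus_inner_mul_eq`, Hales's normalisation).  Here the
sides are only SOFT.  Writing `m = v + w`, `n = a + c`, `p = v − w`, `q = a − c` (`⟪m, p⟫ = ⟪n, q⟫ = 0`
exactly, the three cross pairings `⟪m, q⟫, ⟪n, p⟫, ⟪p, q⟫` are differences of side inner products,
hence small, and `⟪m, n⟫` is their sum):

* `gram_det_eq_zero_fin_four` — four vectors of `ℝ³` have vanishing Gram determinant;
* `rhombus_gram_identity` — for ANY `m n p q : ℝ³` with `⟪m,p⟫ = ⟪n,q⟫ = 0`: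
  `(‖m‖²‖n‖² − ⟪m,n⟫²)(‖p‖²‖q‖² − ⟪p,q⟫²) = ‖m‖²‖q‖²⟪n,p⟫² + ‖n‖²‖p‖²⟪m,q⟫² + 2⟪m,n⟫⟪m,q⟫⟪n,p⟫⟪p,q⟫
  − ⟪m,q⟫²⟪n,p⟫²` (the Gram determinant of `m, n, p, q`, expanded);
* `rhombus_diag_relation` — for unit `v a w c` with the four side inner products within `ε` of `1/2`
  and the two diagonals `⟪v,w⟫, ⟪a,c⟫ ≤ 1/2 + ε` (`0 ≤ ε ≤ 1/100`):
  `σ² ≤ 4 (1 + ⟪v,w⟫)(1 + ⟪a,c⟫) ≤ σ² + 512 ε²` with `σ = ⟪v,a⟫ + ⟪a,w⟫ + ⟪w,c⟫ + ⟪c,v⟫ ∈ [2 − 4ε,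
  2 + 4ε]` — the lower bound is Cauchy–Schwarz for `m, n`, the upper one the identity above.
-/

noncomputable section

namespace Summit.AtomisticToContinuum.Crystallization.Theorems

open Real RealInnerProductSpace Matrix Module

/-- **Four vectors of `ℝ³` have vanishing Gram determinant** (they are linearly dependent, and a
dependence is a kernel vector of the Gram matrix). -/
theorem gram_det_eq_zero_fin_four (u : Fin 4 → EuclideanSpace ℝ (Fin 3)) :
    (Matrix.of fun i j : Fin 4 => ⟪u i, u j⟫).det = 0 := by
  classical
  have hdep : ¬ LinearIndependent ℝ u := by
    intro hli
    have := hli.fintype_card_le_finrank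
    simp at this
  obtain ⟨g, hg, i₀, hi₀⟩ := Fintype.not_linearIndependent_iff.1 hdep
  refine (Matrix.exists_mulVec_eq_zero_iff).1 ⟨g, ?_, ?_⟩
  · intro h0; exact hi₀ (by rw [h0]; rfl)
  · ext j
    simp only [Matrix.mulVec, dotProduct, Matrix.of_apply, Pi.zero_apply]
    calc ∑ i, ⟪u j, u i⟫ * g i = ⟪u j, ∑ i, g i • u i⟫ := by
          rw [inner_sum]; refine Finset.sum_congr rfl fun i _ => ?_
          rw [real_inner_smul_right, mul_comm]
      _ = 0 := by rw [hg, inner_zero_right]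

/-- The determinant of a symmetric `4 × 4` matrix of the shape met below (two zero entries).
-/
theorem det_four_rhombus (M N P Q σ e₁ e₂ e₃ : ℝ) :
    (!![M, σ, 0, e₁; σ, N, e₂, 0; 0, e₂, P, e₃; e₁, 0, e₃, Q] : Matrix (Fin 4) (Fin 4) ℝ).det =
      (M * N - σ ^ 2) * (P * Q - e₃ ^ 2) -
        (M * Q * e₂ ^ 2 + N * P * e₁ ^ 2 + 2 * σ * e₁ * e₂ * e₃ - e₁ ^ 2 * e₂ ^ 2) := by
  rw [Matrix.det_succ_row_zero]
  simp [Fin.sum_univ_succ, Matrix.det_fin_three, Matrix.submatrix, Fin.succAbove]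
  ring

/-- **The Gram identity for an orthogonal double pair.** For `m n p q : ℝ³` with `⟪m, p⟫ = 0` and
`⟪n, q⟫ = 0`, the vanishing of the Gram determinant of `(m, n, p, q)` reads
`(‖m‖²‖n‖² − ⟪m,n⟫²)(‖p‖²‖q‖² − ⟪p,q⟫²) =
  ‖m‖²‖q‖²⟪n,p⟫² + ‖n‖²‖p‖²⟪m,q⟫² + 2⟪m,n⟫⟪m,q⟫⟪n,p⟫⟪p,q⟫ − ⟪m,q⟫²⟪n,p⟫²`. -/
theorem rhombus_gram_identity (m n p q : EuclideanSpace ℝ (Fin 3)) (hmp : ⟪m, p⟫ = 0)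
    (hnq : ⟪n, q⟫ = 0) :
    (⟪m, m⟫ * ⟪n, n⟫ - ⟪m, n⟫ ^ 2) * (⟪p, p⟫ * ⟪q, q⟫ - ⟪p, q⟫ ^ 2) =
      ⟪m, m⟫ * ⟪q, q⟫ * ⟪n, p⟫ ^ 2 + ⟪n, n⟫ * ⟪p, p⟫ * ⟪m, q⟫ ^ 2 +
        2 * ⟪m, n⟫ * ⟪m, q⟫ * ⟪n, p⟫ * ⟪p, q⟫ - ⟪m, q⟫ ^ 2 * ⟪n, p⟫ ^ 2 := by
  have h0 := gram_det_eq_zero_fin_four ![m, n, p, q]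
  have hmat : (Matrix.of fun i j : Fin 4 => ⟪(![m, n, p, q]) i, (![m, n, p, q]) j⟫) =
      !![⟪m, m⟫, ⟪m, n⟫, 0, ⟪m, q⟫; ⟪m, n⟫, ⟪n, n⟫, ⟪n, p⟫, 0; 0, ⟪n, p⟫, ⟪p, p⟫, ⟪p, q⟫;
        ⟪m, q⟫, 0, ⟪p, q⟫, ⟪q, q⟫] := by
    ext i j
    fin_cases i <;> fin_cases j <;>
      simp [Matrix.of_apply, hmp, hnq, real_inner_comm m n, real_inner_comm m q,
        real_inner_comm n p, real_inner_comm p q, real_inner_comm m p, real_inner_comm n q]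
  rw [hmat, det_four_rhombus] at h0
  linarith

/-- The real-arithmetic core of `rhombus_diag_relation`: from the expanded Gram identity and the
side/diagonal bounds, `Δ = (2+2x)(2+2y) − σ² ≤ 512 ε²`. -/
theorem rhombus_arith {x y s₁ s₂ s₃ s₄ ε : ℝ} (hε0 : 0 ≤ ε) (hε : ε ≤ 1 / 100)
    (h1 : |s₁ - 1 / 2| ≤ ε) (h2 : |s₂ - 1 / 2| ≤ ε) (h3 : |s₃ - 1 / 2| ≤ ε) (h4 : |s₄ - 1 / 2| ≤ ε)
    (hx : x ≤ 1 / 2 + ε) (hy : y ≤ 1 / 2 + ε) (hx1 : -1 ≤ x) (hy1 : -1 ≤ y)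
    (hΔ0 : 0 ≤ (2 + 2 * x) * (2 + 2 * y) - (s₁ + s₂ + s₃ + s₄) ^ 2)
    (hid : ((2 + 2 * x) * (2 + 2 * y) - (s₁ + s₂ + s₃ + s₄) ^ 2) *
        ((2 - 2 * x) * (2 - 2 * y) - (s₁ - s₄ - s₂ + s₃) ^ 2) =
      (2 + 2 * x) * (2 - 2 * y) * (s₁ - s₂ + s₄ - s₃) ^ 2 +
        (2 + 2 * y) * (2 - 2 * x) * (s₁ - s₄ + s₂ - s₃) ^ 2 +
        2 * (s₁ + s₂ + s₃ + s₄) * (s₁ - s₄ + s₂ - s₃) * (s₁ - s₂ + s₄ - s₃) * (s₁ - s₄ - s₂ + s₃) -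
        (s₁ - s₄ + s₂ - s₃) ^ 2 * (s₁ - s₂ + s₄ - s₃) ^ 2) :
    (2 + 2 * x) * (2 + 2 * y) - (s₁ + s₂ + s₃ + s₄) ^ 2 ≤ 512 * ε ^ 2 := by
  have a1 := abs_le.1 h1
  have a2 := abs_le.1 h2
  have a3 := abs_le.1 h3
  have a4 := abs_le.1 h4
  have e1 : |s₁ - s₄ + s₂ - s₃| ≤ 4 * ε := by
    rw [abs_le]; constructor <;> linarith only [a1.1, a1.2, a2.1, a2.2, a3.1, a3.2, a4.1, a4.2]
  have e2 : |s₁ - s₂ + s₄ - s₃| ≤ 4 * ε := by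
    rw [abs_le]; constructor <;> linarith only [a1.1, a1.2, a2.1, a2.2, a3.1, a3.2, a4.1, a4.2]
  have e3 : |s₁ - s₄ - s₂ + s₃| ≤ 4 * ε := by
    rw [abs_le]; constructor <;> linarith only [a1.1, a1.2, a2.1, a2.2, a3.1, a3.2, a4.1, a4.2]
  have hA : |s₁ + s₂ + s₃ + s₄| ≤ 2 + 4 * ε := by
    rw [abs_le]; constructor <;> linarith only [a1.1, a1.2, a2.1, a2.2, a3.1, a3.2, a4.1, a4.2, hε0]
  have hεε : ε ^ 2 ≤ 1 / 100 * ε := by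
    have := mul_le_mul_of_nonneg_left hε hε0; rw [pow_two]; linarith only [this]
  have sq_of_abs : ∀ {t b : ℝ}, |t| ≤ b → t ^ 2 ≤ b ^ 2 := fun h => by
    have := pow_le_pow_left₀ (abs_nonneg _) h 2; rwa [sq_abs] at this
  have hb1 : (s₁ - s₄ + s₂ - s₃) ^ 2 ≤ 16 * ε ^ 2 := by linarith only [sq_of_abs e1]
  have hb2 : (s₁ - s₂ + s₄ - s₃) ^ 2 ≤ 16 * ε ^ 2 := by linarith only [sq_of_abs e2]
  have hb3 : (s₁ - s₄ - s₂ + s₃) ^ 2 ≤ 16 * ε ^ 2 := by linarith only [sq_of_abs e3]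
  -- `D ≥ 0.81`
  have hD : (9 / 10 : ℝ) ^ 2 ≤ (2 - 2 * x) * (2 - 2 * y) - (s₁ - s₄ - s₂ + s₃) ^ 2 := by
    have hprod : (1 - 2 * ε) * (1 - 2 * ε) ≤ (2 - 2 * x) * (2 - 2 * y) :=
      mul_le_mul (by linarith only [hx]) (by linarith only [hy]) (by linarith only [hε])
        (by linarith only [hx, hε])
    have hexp : (1 - 2 * ε) * (1 - 2 * ε) = 1 - 4 * ε + 4 * ε ^ 2 := by ring
    linarith only [hprod, hexp, hb3, hεε, hε]
  -- the four terms of the right-hand side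
  have t1 : (2 + 2 * x) * (2 - 2 * y) * (s₁ - s₂ + s₄ - s₃) ^ 2 ≤ (3 + 2 * ε) * 4 * (16 * ε ^ 2) :=
    mul_le_mul (mul_le_mul (by linarith only [hx]) (by linarith only [hy1])
      (by linarith only [hy, hε]) (by linarith only [hε0])) hb2 (sq_nonneg _) (by positivity)
  have t2 : (2 + 2 * y) * (2 - 2 * x) * (s₁ - s₄ + s₂ - s₃) ^ 2 ≤ (3 + 2 * ε) * 4 * (16 * ε ^ 2) :=
    mul_le_mul (mul_le_mul (by linarith only [hy]) (by linarith only [hx1])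
      (by linarith only [hx, hε]) (by linarith only [hε0])) hb1 (sq_nonneg _) (by positivity)
  have t3 : 2 * (s₁ + s₂ + s₃ + s₄) * (s₁ - s₄ + s₂ - s₃) * (s₁ - s₂ + s₄ - s₃) *
      (s₁ - s₄ - s₂ + s₃) ≤ 2 * (2 + 4 * ε) * (4 * ε) * (4 * ε) * (4 * ε) := by
    have hA2 : 2 * |s₁ + s₂ + s₃ + s₄| ≤ 2 * (2 + 4 * ε) := by linarith only [hA]
    have hB : 2 * |s₁ + s₂ + s₃ + s₄| * |s₁ - s₄ + s₂ - s₃| ≤ 2 * (2 + 4 * ε) * (4 * ε) :=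
      mul_le_mul hA2 e1 (abs_nonneg _) (by positivity)
    have hC : 2 * |s₁ + s₂ + s₃ + s₄| * |s₁ - s₄ + s₂ - s₃| * |s₁ - s₂ + s₄ - s₃| ≤
        2 * (2 + 4 * ε) * (4 * ε) * (4 * ε) :=
      mul_le_mul hB e2 (abs_nonneg _) (by positivity)
    have hD' : 2 * |s₁ + s₂ + s₃ + s₄| * |s₁ - s₄ + s₂ - s₃| * |s₁ - s₂ + s₄ - s₃| *
        |s₁ - s₄ - s₂ + s₃| ≤ 2 * (2 + 4 * ε) * (4 * ε) * (4 * ε) * (4 * ε) :=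
      mul_le_mul hC e3 (abs_nonneg _) (by positivity)
    have hE := le_abs_self (2 * (s₁ + s₂ + s₃ + s₄) * (s₁ - s₄ + s₂ - s₃) * (s₁ - s₂ + s₄ - s₃) *
      (s₁ - s₄ - s₂ + s₃))
    rw [abs_mul, abs_mul, abs_mul, abs_mul, abs_two] at hE
    exact hE.trans hD'
  have t4 : 0 ≤ (s₁ - s₄ + s₂ - s₃) ^ 2 * (s₁ - s₂ + s₄ - s₃) ^ 2 := by positivity
  have hε3 : ε ^ 3 ≤ 1 / 100 * ε ^ 2 := by
    have := mul_le_mul_of_nonneg_left hε (sq_nonneg ε)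
    calc ε ^ 3 = ε ^ 2 * ε := by ring
      _ ≤ ε ^ 2 * (1 / 100) := this
      _ = 1 / 100 * ε ^ 2 := by ring
  have hε4 : ε ^ 4 ≤ 1 / 10000 * ε ^ 2 := by
    have := mul_le_mul hεε hεε (sq_nonneg ε) (by positivity)
    calc ε ^ 4 = ε ^ 2 * ε ^ 2 := by ring
      _ ≤ 1 / 100 * ε * (1 / 100 * ε) := this
      _ = 1 / 10000 * ε ^ 2 := by ring
  have x1 : (3 + 2 * ε) * 4 * (16 * ε ^ 2) = 192 * ε ^ 2 + 128 * ε ^ 3 := by ring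
  have x3 : 2 * (2 + 4 * ε) * (4 * ε) * (4 * ε) * (4 * ε) = 256 * ε ^ 3 + 512 * ε ^ 4 := by ring
  have hrhs : ((2 + 2 * x) * (2 + 2 * y) - (s₁ + s₂ + s₃ + s₄) ^ 2) *
      ((2 - 2 * x) * (2 - 2 * y) - (s₁ - s₄ - s₂ + s₃) ^ 2) ≤ 390 * ε ^ 2 := by
    rw [hid]; linarith only [t1, t2, t3, t4, x1, x3, hε3, hε4, sq_nonneg ε]
  -- conclude: `0.81 Δ ≤ Δ D ≤ 390 ε²`
  have k1 := mul_le_mul_of_nonneg_left hD hΔ0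
  by_contra hbig
  push Not at hbig
  nlinarith only [k1, hrhs, hbig, sq_nonneg ε, hΔ0]

/-- **The robust rhombus relation between the diagonals of a soft square.** Let `v, a, w, c` be unit
vectors of `ℝ³` whose four "sides" `⟪v,a⟫, ⟪a,w⟫, ⟪w,c⟫, ⟪c,v⟫` are within `ε` of `1/2` and whose
two "diagonals" satisfy `⟪v,w⟫, ⟪a,c⟫ ≤ 1/2 + ε` (`0 ≤ ε ≤ 1/100`). Then with
`σ = ⟪v,a⟫ + ⟪a,w⟫ + ⟪w,c⟫ + ⟪c,v⟫`:
`σ² ≤ 4 (1 + ⟪v,w⟫)(1 + ⟪a,c⟫) ≤ σ² + 512 ε²`.  (Exact rhombus: `σ = 2`, `(1+⟪v,w⟫)(1+⟪a,c⟫) = 1`.) -/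
theorem rhombus_diag_relation {v a w c : EuclideanSpace ℝ (Fin 3)} (hv : ‖v‖ = 1) (ha : ‖a‖ = 1)
    (hw : ‖w‖ = 1) (hc : ‖c‖ = 1) {ε : ℝ} (hε0 : 0 ≤ ε) (hε : ε ≤ 1 / 100)
    (h1 : |⟪v, a⟫ - 1 / 2| ≤ ε) (h2 : |⟪a, w⟫ - 1 / 2| ≤ ε) (h3 : |⟪w, c⟫ - 1 / 2| ≤ ε)
    (h4 : |⟪c, v⟫ - 1 / 2| ≤ ε) (hx : ⟪v, w⟫ ≤ 1 / 2 + ε) (hy : ⟪a, c⟫ ≤ 1 / 2 + ε) :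
    (⟪v, a⟫ + ⟪a, w⟫ + ⟪w, c⟫ + ⟪c, v⟫) ^ 2 ≤ 4 * ((1 + ⟪v, w⟫) * (1 + ⟪a, c⟫)) ∧
      4 * ((1 + ⟪v, w⟫) * (1 + ⟪a, c⟫)) ≤
        (⟪v, a⟫ + ⟪a, w⟫ + ⟪w, c⟫ + ⟪c, v⟫) ^ 2 + 512 * ε ^ 2 := by
  have hvv : ⟪v, v⟫ = 1 := by rw [real_inner_self_eq_norm_sq, hv]; norm_num
  have haa : ⟪a, a⟫ = 1 := by rw [real_inner_self_eq_norm_sq, ha]; norm_num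
  have hww : ⟪w, w⟫ = 1 := by rw [real_inner_self_eq_norm_sq, hw]; norm_num
  have hcc : ⟪c, c⟫ = 1 := by rw [real_inner_self_eq_norm_sq, hc]; norm_num
  have hwv : ⟪w, v⟫ = ⟪v, w⟫ := real_inner_comm _ _
  have hca : ⟪c, a⟫ = ⟪a, c⟫ := real_inner_comm _ _
  have hav : ⟪a, v⟫ = ⟪v, a⟫ := real_inner_comm _ _
  have hwa : ⟪w, a⟫ = ⟪a, w⟫ := real_inner_comm _ _
  have hcw : ⟪c, w⟫ = ⟪w, c⟫ := real_inner_comm _ _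
  have hvc : ⟪v, c⟫ = ⟪c, v⟫ := real_inner_comm _ _
  have iMM : ⟪v + w, v + w⟫ = 2 + 2 * ⟪v, w⟫ := by
    simp only [inner_add_left, inner_add_right, hvv, hww, hwv]; ring
  have iNN : ⟪a + c, a + c⟫ = 2 + 2 * ⟪a, c⟫ := by
    simp only [inner_add_left, inner_add_right, haa, hcc, hca]; ring
  have iPP : ⟪v - w, v - w⟫ = 2 - 2 * ⟪v, w⟫ := by
    simp only [inner_sub_left, inner_sub_right, hvv, hww, hwv]; ring
  have iQQ : ⟪a - c, a - c⟫ = 2 - 2 * ⟪a, c⟫ := by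
    simp only [inner_sub_left, inner_sub_right, haa, hcc, hca]; ring
  have iMN : ⟪v + w, a + c⟫ = ⟪v, a⟫ + ⟪a, w⟫ + ⟪w, c⟫ + ⟪c, v⟫ := by
    simp only [inner_add_left, inner_add_right, hwa, hvc]; ring
  have iMP : ⟪v + w, v - w⟫ = 0 := by
    simp only [inner_add_left, inner_sub_right, hvv, hww, hwv]; ring
  have iNQ : ⟪a + c, a - c⟫ = 0 := by
    simp only [inner_add_left, inner_sub_right, haa, hcc, hca]; ring
  have iMQ : ⟪v + w, a - c⟫ = ⟪v, a⟫ - ⟪c, v⟫ + ⟪a, w⟫ - ⟪w, c⟫ := by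
    simp only [inner_add_left, inner_sub_right, hvc, hwa]; ring
  have iNP : ⟪a + c, v - w⟫ = ⟪v, a⟫ - ⟪a, w⟫ + ⟪c, v⟫ - ⟪w, c⟫ := by
    simp only [inner_add_left, inner_sub_right, hav, hcw]; ring
  have iPQ : ⟪v - w, a - c⟫ = ⟪v, a⟫ - ⟪c, v⟫ - ⟪a, w⟫ + ⟪w, c⟫ := by
    simp only [inner_sub_left, inner_sub_right, hvc, hwa]; ring
  have hid := rhombus_gram_identity (v + w) (a + c) (v - w) (a - c) iMP iNQ
  rw [iMM, iNN, iPP, iQQ, iMN, iMQ, iNP, iPQ] at hid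
  have hx1 : -1 ≤ ⟪v, w⟫ := by
    have := neg_le_of_abs_le (abs_real_inner_le_norm v w); rw [hv, hw, one_mul] at this; exact this
  have hy1 : -1 ≤ ⟪a, c⟫ := by
    have := neg_le_of_abs_le (abs_real_inner_le_norm a c); rw [ha, hc, one_mul] at this; exact this
  -- Cauchy–Schwarz for `m, n`: `Δ ≥ 0`
  have hΔ0 : 0 ≤ (2 + 2 * ⟪v, w⟫) * (2 + 2 * ⟪a, c⟫) - (⟪v, a⟫ + ⟪a, w⟫ + ⟪w, c⟫ + ⟪c, v⟫) ^ 2 := by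
    have hcs := abs_real_inner_le_norm (v + w) (a + c)
    have hmn : ‖v + w‖ * ‖a + c‖ = Real.sqrt ((2 + 2 * ⟪v, w⟫) * (2 + 2 * ⟪a, c⟫)) := by
      rw [Real.sqrt_mul (by linarith), ← iMM, ← iNN, real_inner_self_eq_norm_sq,
        real_inner_self_eq_norm_sq, Real.sqrt_sq (norm_nonneg _), Real.sqrt_sq (norm_nonneg _)]
    rw [hmn, iMN] at hcs
    have hsq := pow_le_pow_left₀ (abs_nonneg _) hcs 2
    rw [sq_abs, Real.sq_sqrt (mul_nonneg (by linarith) (by linarith))] at hsq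
    linarith
  have h4e : (2 + 2 * ⟪v, w⟫) * (2 + 2 * ⟪a, c⟫) = 4 * ((1 + ⟪v, w⟫) * (1 + ⟪a, c⟫)) := by ring
  refine ⟨by linarith, ?_⟩
  have := rhombus_arith hε0 hε h1 h2 h3 h4 hx hy hx1 hy1 hΔ0 hid
  linarith

/-- **The long diagonal of a soft square is not too long**: under the hypotheses of
`rhombus_diag_relation`, `⟪v, w⟫ ≥ −1/3 − 4ε` (exact rhombus: `(1 + ⟪v,w⟫)(1 + ⟪a,c⟫) = 1` and
`⟪a, c⟫ ≤ 1/2` give `⟪v, w⟫ ≥ −1/3`, Bezdek–Reid's "rhombus angle `≤ 141.06°`"). -/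
theorem soft_rhombus_diag_ge {v a w c : EuclideanSpace ℝ (Fin 3)} (hv : ‖v‖ = 1) (ha : ‖a‖ = 1)
    (hw : ‖w‖ = 1) (hc : ‖c‖ = 1) {ε : ℝ} (hε0 : 0 ≤ ε) (hε : ε ≤ 1 / 100)
    (h1 : |⟪v, a⟫ - 1 / 2| ≤ ε) (h2 : |⟪a, w⟫ - 1 / 2| ≤ ε) (h3 : |⟪w, c⟫ - 1 / 2| ≤ ε)
    (h4 : |⟪c, v⟫ - 1 / 2| ≤ ε) (hx : ⟪v, w⟫ ≤ 1 / 2 + ε) (hy : ⟪a, c⟫ ≤ 1 / 2 + ε) :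
    -1 / 3 - 4 * ε ≤ ⟪v, w⟫ := by
  have hrel := (rhombus_diag_relation hv ha hw hc hε0 hε h1 h2 h3 h4 hx hy).1
  have a1 := abs_le.1 h1
  have a2 := abs_le.1 h2
  have a3 := abs_le.1 h3
  have a4 := abs_le.1 h4
  have hσ : 2 - 4 * ε ≤ ⟪v, a⟫ + ⟪a, w⟫ + ⟪w, c⟫ + ⟪c, v⟫ := by
    linarith only [a1.1, a2.1, a3.1, a4.1]
  have hσ0 : 0 ≤ 2 - 4 * ε := by linarith only [hε]
  have hσ2 : (2 - 4 * ε) ^ 2 ≤ (⟪v, a⟫ + ⟪a, w⟫ + ⟪w, c⟫ + ⟪c, v⟫) ^ 2 :=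
    pow_le_pow_left₀ hσ0 hσ 2
  have hx1 : 0 ≤ 1 + ⟪v, w⟫ := by
    have := neg_le_of_abs_le (abs_real_inner_le_norm v w); rw [hv, hw, one_mul] at this
    linarith only [this]
  -- `(2 − 4ε)² ≤ 4 (1 + x)(1 + y) ≤ 4 (1 + x)(3/2 + ε)`
  have hup : 4 * ((1 + ⟪v, w⟫) * (1 + ⟪a, c⟫)) ≤ 4 * ((1 + ⟪v, w⟫) * (3 / 2 + ε)) := by
    have := mul_le_mul_of_nonneg_left (show 1 + ⟪a, c⟫ ≤ 3 / 2 + ε by linarith only [hy]) hx1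
    linarith only [this]
  have hchain : (2 - 4 * ε) ^ 2 ≤ 4 * ((1 + ⟪v, w⟫) * (3 / 2 + ε)) := hσ2.trans (hrel.trans hup)
  -- `(3/2 + ε)(2/3 − 4ε) ≤ (1 − 2ε)²`
  have hpos : (0 : ℝ) < 3 / 2 + ε := by linarith only [hε0]
  by_contra hlt
  push Not at hlt
  have : 4 * ((1 + ⟪v, w⟫) * (3 / 2 + ε)) < 4 * ((2 / 3 - 4 * ε) * (3 / 2 + ε)) := by
    have := mul_lt_mul_of_pos_right (show 1 + ⟪v, w⟫ < 2 / 3 - 4 * ε by linarith only [hlt]) hpos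
    linarith only [this]
  nlinarith only [hchain, this, hε0, hε]

end Summit.AtomisticToContinuum.Crystallization.Theorems

end
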